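/-
Copyright: the b2b-balaban T⁴-continuum CRUX team, row NE7b leaf lineage `t4-ne7b-formalise-leaf-05` (gen 159). Project licence.
-/
import Summits.QuantumFields.BalabanUV.T4Continuum.Spine.NE7b.BlockAverageDirichletDomination
import Summits.QuantumFields.BalabanUV.T4Continuum.Support.ScalarBlockPoincareLocal

/-!
# THE KERNEL FLOOR OF THE NEXT AVERAGING ON PRINT's TORUS, AND THE HARD FLOW's PER-SCALE RESET BY VALUE: on the unit lattice
# `T₁ = Tor (fine L M′)` every real field with vanishing `L`-block means (`Q′_L g = 0`, `Q′ = B5Block118.QsOp`) has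
# `(2∕L²)·Σ_y g(y)² ≤ Σ_y Σ_μ (g(y+e_μ) − g(y))²` — `…DominationTransfer`'s `hR` slot INHABITED, `m = 2∕L²`, from the tree's block
# Poincaré inequality `…Support.ScalarBlockPoincareLocal.nsq_sub_PiS_le_half` BY NAME; composed with `…BlockAverageDirichletDomination`
# (`hRQ`, `γ = 1`) and DMT's `kerCoercive_transported_of_domination`: along ANY section `T` of the composite block average `Q′_n`
# (`n = L^k`) the transported `η^d`-weighted fine Dirichlet form is `(2∕L²)`-COERCIVE ON `ker Q′_L` — a floor free of `k`, of the volume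
# and of `d` (row NE7b, node U5c; [folklore] over the tree's kernel theorems BY NAME)

Cell `pub-balaban`, sub-cell `t4`, spine estimate NE7b (`T4WeightBudget.RelWeightBound`; the cell's OWN estimate — NOT PRINTED in
[Bałaban 1983–89], NOT PROVED).  Crux-route work under `Spine/NE7b/` by a row leaf (`t4-ne7b-formalise-leaf-05` gen 159) under FREEZE (0)'s
crux-prover clause; the companion of `…BlockAverageDirichletDomination` (BADD, the OWNER's W-ne7bp1-g111-2 (ii)).  NOTHING of Bałaban's is asserted:
the inputs are the tree's KERNEL theorems — NE2 leaf-09's block Poincaré inequality for 0-forms on print's blocks `B^k(y)` of (1.6)∕(1.20)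
(`…Support.ScalarBlockPoincareLocal.nsq_sub_PiS_le_half`: `nsq (f − Π′f) ≤ ½·Σ_ν nsq (∂_ν f)`, `Π′ = n^d·Q′ᴴQ′`, `∂_ν = n(S_ν − 1)`, constant free of
`d`, `n` and the torus), `…Support.ScalarBlockPoincare.PiS_mulVec`, `B5RealFields`, BADD, `…MatrixFormJunction` (37), `…DominationTransfer` (DMT).
No `T4Continuum/Support` leaf typed (two are READ); no `def`; zero `sorry`.

WHY.  DMT's per-scale reset `kerCoercive_transported_of_domination` takes two letters: `hRQ` (the fine form dominates the pullback of the coarse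
MODEL form — BADD, `γ = 1`, on print's torus) and `hR` (the coarse model form is `m`-coercive on the kernel of the NEXT averaging `D₂`).  For the
hard scalar flow on print's objects the coarse model form is the unit-lattice Dirichlet form on `T₁ = Tor M`, `M = fine L M′`, and `D₂ = Q′_L`; so
`hR` is a block Poincaré inequality on the `L`-blocks of the unit torus for block-mean-free fields.  That inequality is IN THE TREE for every
side and every torus (NE2's `ScalarBlockPoincare(Local)`, typed for the gauge-term row of node U1a); on `ker Q′_L` the projector `Π′` vanishes
(`PiS_mulVec`) and `∂_ν = L(S_ν − 1)` is `L` times the unit difference, whence `nsq g ≤ (L²∕2)·nsq (∂₁ g)`, i.e. `m = 2∕L²` in BADD's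
real `dotProduct` currency — the hypothesis `h` of `…MatrixFormJunction.kerCoercive_transfer`.  DMT then gives, for ANY continuous right
inverse `T` of `Q′_n` (the composite average from `T_η`, `η = 1∕n`, `n = L^k`, to `T₁`): `D₂ g = 0 ⟹ (2∕L²)‖g‖² ≤ Q (T g) (T g)` — the
transported fine Dirichlet form's floor on the next fibre, with NO transport loss and NO dependence on `k`, the volume or `d` (compare TFC's
`m₂∕d²` and the pricing desk's per-step loss `×1.155`, F698∕F699).

WHAT IS PROVED ([folklore]; `L ≥ 1` via `[NeZero L]`, `M′ : Fin d → ℕ` with `M′ μ ≥ 1`, any `d`; in §4 also `n ≥ 1`):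
* §1 `PiS_mulVec_eq_zero_of_QsOp` (`Q′_L g = 0 ⟹ Π′ g = 0`), `sum_nsq_sdiff_eq` (`Σ_ν nsq (∂_ν^{(c)} g) = ‖c‖²·nsq (∂₁ g)` with
  `∂₁ = GradOp (fine L M′) 1`), **`nsq_le_of_QsOp_eq_zero`** (`Q′_L g = 0 ⟹ (2∕L²)·nsq g ≤ nsq (∂₁ g)`, complex fields),
  `nsq_le_of_QsOp_eq_zero_sharp` (`L ≥ 2`: floor `2∕(L(L−1))` from the IN-BLOCK letter `…nsq_sub_PiS_le_inBlock_sharp`; `1` at `L = 2`).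
* §2 REAL `dotProduct` CURRENCY: **`kernelFloor_dot`** — `∀ v : Tor (fine L M′) → ℝ`, `reM Q′_L v = 0 → (2∕L²)·(v ⬝ v) ≤ v ⬝ ((reM ∂₁)ᵀ(reM ∂₁) v)`
  — literally the `h` of `…MatrixFormJunction.kerCoercive_transfer` with `Dm = reM Q′_L` and BADD's coarse matrix `S`.
* §3 THE CLM LETTER: **`kernelFloor_CLM`** — for `R`, `D₂` characterised in coordinates by `S`, `reM Q′_L`: `∀ g, D₂ g = 0 → (2∕L²)‖g‖² ≤ R g g`
  (DMT's `hR`, `m = 2∕L²`); `exists_kernelFloor_CLM` (the pair `(R, D₂)` exists).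
* §4 **THE PER-SCALE RESET BY VALUE ON PRINT's TORUS**: **`hardFlow_nextFloor_of_section`** — `E = EuclideanSpace ℝ (Tor (fine n (fine L M′)))`,
  `F = EuclideanSpace ℝ (Tor (fine L M′))`, `G = EuclideanSpace ℝ (Tor M′)`; `Q`, `R`, `D`, `D₂` characterised in coordinates by BADD's `A`
  (`η^d`-weighted fine Dirichlet), `S` (unit-lattice Dirichlet), `reM Q′_n`, `reM Q′_L`; `T : F →L E` with `D (T g) = g` ⟹
  `∀ g, D₂ g = 0 → 1·(2∕L²)·‖g‖² ≤ (Q.bilinearComp T T) g g` (DMT `kerCoercive_transported_of_domination` on BADD `blockAverage_domination_dot` +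
  §2).
* §4b THE LETTERS ARE JOINTLY INHABITED: `QsOp_mul_smul_conjTranspose` (`Q′_n·(n^d·Q′_nᴴ) = 1` — `B5Blocks16.QsOp_blockConst` +
  `…ScalarBlockPoincare.QsOp_conjTranspose_mulVec` BY NAME), `reM_QsOp_mul_blockConst` (real matrices), **`exists_blockConstant_section`** (the
  block-constant extension `T₀ g = g ∘ blockOf` as a CLM right inverse of `D`, `…MatrixFormJunction.section_transfer`), and
  **`hardFlow_nextFloor_blockConstant`** (`∃ Q R D D₂ T₀` with all five coordinate characterisations, `D (T₀ g) = g` and the floor `2∕L²` on `ker D₂`).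
* §5 toy: at `L = 2` the floor is `½`, at `L = 3` it is `2∕9`.

NOT HERE (honest): the MINIMISING section (where `Q.bilinearComp T T` is the effective fine Dirichlet form; `B5Hk165…` ∕ FFTI's cube) — §4b
inhabits `hT` with the block-constant `T₀` only, along which `Q.bilinearComp T₀ T₀ = n·R` is crude; the size
direction (THEC), the sharp floor carried through §2–§4 (they use `2∕L²`; `nsq_le_of_QsOp_eq_zero_sharp` is the drop-in supplier for
`2∕(L(L−1))`), the `ℓ²(ℤ^d)` carrier, covariant `U ≠ 1`, anything of Bałaban's small-field action ((A3) ∕ (A1c), NC-NE7b-α UNRULED).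
BY-NAME EFFECT ON THE WALL: NONE (the hard-step cell's two floor letters inhabited for the free scalar flow; the wall is (R2)).  NE7b NOT
PRINTED ∕ NOT PROVED; spine PROVED 0∕9; rung (B)+1 on a FINITE torus — NOT infinite volume, NOT the mass gap, NOT Clay.  HONEST DEPENDENCY:
continuum YM on T⁴ ⇐ BetaPertH ∧ nine spine estimates (0∕9 proved); BetaPertH ⇐ (D1) ∧ (D4) ∧ CAP+tail; G-an2-4 gates asym, D1 and NE2∕3∕4.
-/

set_option autoImplicit false

namespace Summit.QuantumFields.BalabanUV.T4Continuum.NE7b.BlockAverageKernelFloor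

open Matrix WithLp Finset
open Literature.MathematicalPhysics.QuantumFieldTheory.Balaban1983to89
open B5Prop11Plancherel (Tor fine unitVec)
open B5Prop11Lower (nsq nsq_nonneg)
open B5Action121 (GradOp sdiff GradOp_mulVec sdiff_mulVec)
open B5Block118 (QsOp bpt)
open B5AverageCurlStokes (sum_blocks_real)
open B5RealFields (IsReal reM cplx isReal_QsOp isReal_GradOp nsq_cplx cplx_eq_zero_iff)
open Summit.QuantumFields.BalabanUV.T4Continuum.ScalarBlockPoincare (PiS PiS_mulVec)
open Summit.QuantumFields.BalabanUV.T4Continuum.ScalarBlockPoincareLocal (nsq_sub_PiS_le_half nsq_sub_PiS_le_inBlock_sharp)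
open Summit.QuantumFields.BalabanUV.T4Continuum.NE7b.MatrixFormJunction
  (exists_form exists_map kerCoercive_transfer domination_transfer section_transfer)
open Summit.QuantumFields.BalabanUV.T4Continuum.NE7b.DominationTransfer (kerCoercive_transported_of_domination)
open Summit.QuantumFields.BalabanUV.T4Continuum.NE7b.BlockAverageDirichletDomination
  (dot_transpose_mul_self sum_sq_reM_mulVec blockAverage_domination_dot)

variable {d : ℕ} (L : ℕ) [NeZero L] (M' : Fin d → ℕ) [hM : ∀ μ, NeZero (M' μ)]

/-! ## §1. The kernel floor in complex `nsq` currency -/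

/-- On `ker Q′_L` the block-mean projector vanishes: `Q′_L g = 0 ⟹ Π′ g = 0` (`Π′ = L^d·Q′ᴴQ′`, `…ScalarBlockPoincare.PiS_mulVec`). [folklore] -/
theorem PiS_mulVec_eq_zero_of_QsOp (g : Tor (fine L M') → ℂ) (hg : QsOp L M' *ᵥ g = 0) : PiS L M' *ᵥ g = 0 := by
  funext x
  rw [PiS_mulVec, hg]
  rfl

omit hM in
/-- `Σ_ν nsq (∂_ν^{(c)} g) = ‖c‖²·nsq (∂₁ g)`: the lattice factor `c` of `sdiff` against the unit gradient `GradOp _ 1`. [folklore] -/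
theorem sum_nsq_sdiff_eq {N : Fin d → ℕ} [∀ μ, NeZero (N μ)] (c : ℂ) (g : Tor N → ℂ) :
    ∑ ν, nsq (sdiff N c ν *ᵥ g) = ‖c‖ ^ 2 * nsq (GradOp N 1 *ᵥ g) := by
  simp only [nsq, Fintype.sum_prod_type, GradOp_mulVec, sdiff_mulVec, one_mul, norm_mul, mul_pow, Finset.mul_sum]
  rw [Finset.sum_comm]

/-- **THE KERNEL FLOOR**: `Q′_L g = 0 ⟹ (2∕L²)·nsq g ≤ nsq (∂₁ g)` (`∂₁ = GradOp (fine L M′) 1`, unit differences on the unit torus) — the tree's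
block Poincaré inequality `nsq (g − Π′g) ≤ ½·Σ_ν nsq (∂_ν g)` (`…ScalarBlockPoincareLocal.nsq_sub_PiS_le_half`, `∂_ν = L(S_ν − 1)`) on the
kernel. [folklore] -/
theorem nsq_le_of_QsOp_eq_zero (g : Tor (fine L M') → ℂ) (hg : QsOp L M' *ᵥ g = 0) :
    2 / (L : ℝ) ^ 2 * nsq g ≤ nsq (GradOp (fine L M') 1 *ᵥ g) := by
  have hL : (0 : ℝ) < L := by exact_mod_cast Nat.pos_of_ne_zero (NeZero.ne L)
  have h := nsq_sub_PiS_le_half L M' g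
  rw [PiS_mulVec_eq_zero_of_QsOp L M' g hg, sub_zero, sum_nsq_sdiff_eq, Complex.norm_natCast] at h
  rw [div_mul_eq_mul_div, div_le_iff₀ (by positivity)]
  linarith

/-- **THE SHARP KERNEL FLOOR** (`L ≥ 2`): `Q′_L g = 0 ⟹ (2∕(L(L−1)))·nsq g ≤ nsq (∂₁ g)` — the path-Poincaré constant `L(L−1)∕2` of the
tree's IN-BLOCK letter `…ScalarBlockPoincareLocal.nsq_sub_PiS_le_inBlock_sharp` (only bonds inside the blocks are charged there; here the
in-block sums are bounded by the full ones, `B5AverageCurlStokes.sum_blocks_real` BY NAME).  At `L = 2` the floor is `1` (vs `½` above). [folklore] -/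
theorem nsq_le_of_QsOp_eq_zero_sharp {L : ℕ} [NeZero L] (hL : 2 ≤ L) (M' : Fin d → ℕ) [∀ μ, NeZero (M' μ)]
    (g : Tor (fine L M') → ℂ) (hg : QsOp L M' *ᵥ g = 0) :
    2 / ((L : ℝ) * ((L : ℝ) - 1)) * nsq g ≤ nsq (GradOp (fine L M') 1 *ᵥ g) := by
  have hL1 : (1 : ℝ) < L := by exact_mod_cast hL
  have hLL : (0 : ℝ) < (L : ℝ) * ((L : ℝ) - 1) := mul_pos (by linarith) (by linarith)
  have h := nsq_sub_PiS_le_inBlock_sharp L M' g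
  rw [PiS_mulVec_eq_zero_of_QsOp L M' g hg, sub_zero] at h
  -- the in-block sums are bounded by the full sums, block by block
  have hin : ∀ ν : Fin d, (∑ y : Tor M', ∑ j ∈ univ.filter (fun j : Fin d → Fin L => (j ν : ℕ) + 1 < L),
      ‖(sdiff (fine L M') (L : ℂ) ν *ᵥ g) (bpt L M' y j)‖ ^ 2) ≤ nsq (sdiff (fine L M') (L : ℂ) ν *ᵥ g) := by
    intro ν
    unfold nsq
    rw [sum_blocks_real L M' (fun x => ‖(sdiff (fine L M') (L : ℂ) ν *ᵥ g) x‖ ^ 2)]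
    exact Finset.sum_le_sum fun y _ =>
      Finset.sum_le_sum_of_subset_of_nonneg (Finset.filter_subset _ _) fun _ _ _ => by positivity
  have hcoef : 0 ≤ ((L : ℝ) - 1) / (2 * L) := by positivity
  have h2 : nsq g ≤ ((L : ℝ) - 1) / (2 * L) * (‖(L : ℂ)‖ ^ 2 * nsq (GradOp (fine L M') 1 *ᵥ g)) := by
    refine h.trans (mul_le_mul_of_nonneg_left ?_ hcoef)
    rw [← sum_nsq_sdiff_eq]
    exact Finset.sum_le_sum fun ν _ => hin ν
  rw [Complex.norm_natCast] at h2
  rw [div_mul_eq_mul_div, div_le_iff₀ hLL]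
  have hL0 : (0 : ℝ) < L := by linarith
  have e : ((L : ℝ) - 1) / (2 * L) * ((L : ℝ) ^ 2 * nsq (GradOp (fine L M') 1 *ᵥ g))
      = (L : ℝ) * ((L : ℝ) - 1) / 2 * nsq (GradOp (fine L M') 1 *ᵥ g) := by
    field_simp
  rw [e] at h2
  linarith

/-! ## §2. Real `dotProduct` currency: the hypothesis of `…MatrixFormJunction.kerCoercive_transfer` -/

/-- **THE KERNEL FLOOR IN REAL `dotProduct` CURRENCY, `m = 2∕L²`** — literally the hypothesis `h` of `…MatrixFormJunction.kerCoercive_transfer`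
with `Dm = reM Q′_L` and the unit-lattice Dirichlet matrix `S = (reM ∂₁)ᵀ(reM ∂₁)` of BADD: for every real field `v` on `Tor (fine L M′)` with
vanishing `L`-block means, `(2∕L²)·(v ⬝ v) ≤ v ⬝ (S v)`. [folklore] -/
theorem kernelFloor_dot (v : Tor (fine L M') → ℝ) (hv : reM (QsOp L M') *ᵥ v = 0) :
    2 / (L : ℝ) ^ 2 * (v ⬝ᵥ v)
      ≤ v ⬝ᵥ (((reM (GradOp (fine L M') 1))ᵀ * reM (GradOp (fine L M') 1)) *ᵥ v) := by
  have h1r : IsReal (GradOp (fine L M') (1 : ℂ)) := isReal_GradOp (fine L M') (by simp)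
  have hker : QsOp L M' *ᵥ cplx v = 0 := by
    rw [← (isReal_QsOp L M').cplx_mulVec, hv]; exact (cplx_eq_zero_iff _).mpr rfl
  have hvv : v ⬝ᵥ v = nsq (cplx v) := by rw [nsq_cplx]; simp only [dotProduct, sq]
  rw [dot_transpose_mul_self, sum_sq_reM_mulVec h1r, hvv]
  exact nsq_le_of_QsOp_eq_zero L M' (cplx v) hker

/-! ## §3. The CLM letter: DMT's `hR`, `m = 2∕L²` -/

/-- **DMT's `hR` ON PRINT's TORUS**: for a continuous bilinear form `R` on `F = EuclideanSpace ℝ (Tor (fine L M′))` and a continuous linear map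
`D₂ : F →L EuclideanSpace ℝ (Tor M′)`, characterised in coordinates by the unit-lattice Dirichlet matrix and by `reM Q′_L`,
`∀ g, D₂ g = 0 → (2∕L²)·‖g‖² ≤ R g g`. [folklore] -/
theorem kernelFloor_CLM
    {R : EuclideanSpace ℝ (Tor (fine L M')) →L[ℝ] EuclideanSpace ℝ (Tor (fine L M')) →L[ℝ] ℝ}
    {D₂ : EuclideanSpace ℝ (Tor (fine L M')) →L[ℝ] EuclideanSpace ℝ (Tor M')}
    (hR : ∀ g h, R g h = ofLp g ⬝ᵥ (((reM (GradOp (fine L M') 1))ᵀ * reM (GradOp (fine L M') 1)) *ᵥ ofLp h))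
    (hD₂ : ∀ g, ofLp (D₂ g) = reM (QsOp L M') *ᵥ ofLp g) (g : EuclideanSpace ℝ (Tor (fine L M'))) (hg : D₂ g = 0) :
    2 / (L : ℝ) ^ 2 * ‖g‖ ^ 2 ≤ R g g :=
  kerCoercive_transfer hR hD₂ (kernelFloor_dot L M') g hg

/-- The pair `(R, D₂)` EXISTS with those coordinate characterisations (so the letter is not empty). [folklore] -/
theorem exists_kernelFloor_CLM :
    ∃ (R : EuclideanSpace ℝ (Tor (fine L M')) →L[ℝ] EuclideanSpace ℝ (Tor (fine L M')) →L[ℝ] ℝ)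
      (D₂ : EuclideanSpace ℝ (Tor (fine L M')) →L[ℝ] EuclideanSpace ℝ (Tor M')),
      (∀ g h, R g h = ofLp g ⬝ᵥ (((reM (GradOp (fine L M') 1))ᵀ * reM (GradOp (fine L M') 1)) *ᵥ ofLp h)) ∧
      (∀ g, ofLp (D₂ g) = reM (QsOp L M') *ᵥ ofLp g) ∧
      (∀ g, D₂ g = 0 → 2 / (L : ℝ) ^ 2 * ‖g‖ ^ 2 ≤ R g g) := by
  classical
  obtain ⟨R, hR⟩ := exists_form (ι := Tor (fine L M')) ((reM (GradOp (fine L M') 1))ᵀ * reM (GradOp (fine L M') 1))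
  obtain ⟨D₂, hD₂⟩ := exists_map (ι := Tor (fine L M')) (κ := Tor M') (reM (QsOp L M'))
  exact ⟨R, D₂, hR, hD₂, kernelFloor_CLM L M' hR hD₂⟩

/-! ## §4. The per-scale reset BY VALUE: the transported fine form is `(2∕L²)`-coercive on the next fibre, along any section -/

/-- **THE HARD FLOW's PER-SCALE RESET ON PRINT's TORUS, BY VALUE, LEVEL-FREE.**  Fine torus `T_η = Tor (fine n (fine L M′))` (`η = 1∕n`,
ANY `n ≥ 1` — the composite `n = L^k` of `k` hard steps), unit torus `T₁ = Tor (fine L M′)`, next torus `Tor M′`; `Q` = the `η^d`-weighted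
fine Dirichlet form, `D` = print's block average `Q′_n` (BADD's coordinates), `R` = the unit-lattice Dirichlet form, `D₂` = the next average
`Q′_L`; `T` ANY continuous right inverse of `D`.  Then on the next fibre the transported form has the floor `2∕L²`:
`D₂ g = 0 ⟹ 1·(2∕L²)·‖g‖² ≤ (Q.bilinearComp T T) g g` — DMT `kerCoercive_transported_of_domination` BY NAME on BADD's `hRQ` (`γ = 1`) and
§2's `hR` (`m = 2∕L²`); no `n`, no volume, no `d` in the constant. [folklore] -/
theorem hardFlow_nextFloor_of_section (n : ℕ) [NeZero n]
    {Q : EuclideanSpace ℝ (Tor (fine n (fine L M'))) →L[ℝ] EuclideanSpace ℝ (Tor (fine n (fine L M'))) →L[ℝ] ℝ}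
    {R : EuclideanSpace ℝ (Tor (fine L M')) →L[ℝ] EuclideanSpace ℝ (Tor (fine L M')) →L[ℝ] ℝ}
    {D : EuclideanSpace ℝ (Tor (fine n (fine L M'))) →L[ℝ] EuclideanSpace ℝ (Tor (fine L M'))}
    {T : EuclideanSpace ℝ (Tor (fine L M')) →L[ℝ] EuclideanSpace ℝ (Tor (fine n (fine L M')))}
    {D₂ : EuclideanSpace ℝ (Tor (fine L M')) →L[ℝ] EuclideanSpace ℝ (Tor M')}
    (hQ : ∀ x y, Q x y = ofLp x ⬝ᵥ
      (((1 / (n : ℝ) ^ d) • ((reM (GradOp (fine n (fine L M')) (n : ℂ)))ᵀ * reM (GradOp (fine n (fine L M')) (n : ℂ)))) *ᵥ ofLp y))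
    (hR : ∀ g h, R g h = ofLp g ⬝ᵥ (((reM (GradOp (fine L M') 1))ᵀ * reM (GradOp (fine L M') 1)) *ᵥ ofLp h))
    (hD : ∀ x, ofLp (D x) = reM (QsOp n (fine L M')) *ᵥ ofLp x) (hT : ∀ g, D (T g) = g)
    (hD₂ : ∀ g, ofLp (D₂ g) = reM (QsOp L M') *ᵥ ofLp g) :
    ∀ g, D₂ g = 0 → 1 * (2 / (L : ℝ) ^ 2) * ‖g‖ ^ 2 ≤ (Q.bilinearComp T T) g g :=
  kerCoercive_transported_of_domination Q R hT zero_le_one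
    (domination_transfer hQ hR hD (blockAverage_domination_dot n (fine L M'))) D₂ (kernelFloor_CLM L M' hR hD₂)

/-! ## §4b. The letters are jointly inhabited: the block-constant section of print's `Q′_n` -/

section BlockConstant

variable (n : ℕ) [NeZero n] (M : Fin d → ℕ) [∀ μ, NeZero (M μ)]

/-- **`Q′_n · (n^d·Q′_nᴴ) = 1`**: the block-constant extension `g ↦ g ∘ blockOf` (`= n^d·Q′_nᴴ g`, `…ScalarBlockPoincare.QsOp_conjTranspose_mulVec`)
is a right inverse of print's block average (`B5Blocks16.QsOp_blockConst`: the block mean of a block-constant field is its value). [folklore] -/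
theorem QsOp_mul_smul_conjTranspose : QsOp n M * (((n : ℂ) ^ d) • (QsOp n M)ᴴ) = 1 := by
  classical
  refine Beta.VectorPropagatorDict.ext_of_mulVec' fun g => ?_
  have hext : (((n : ℂ) ^ d) • (QsOp n M)ᴴ) *ᵥ g = fun x => g (B5Blocks16.blockOf n M x) := by
    funext x
    have hn : ((n : ℂ) ^ d) ≠ 0 := pow_ne_zero _ (by exact_mod_cast NeZero.ne n)
    rw [Matrix.smul_mulVec, Pi.smul_apply, ScalarBlockPoincare.QsOp_conjTranspose_mulVec, smul_eq_mul]
    field_simp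
  rw [← Matrix.mulVec_mulVec, hext, B5Blocks16.QsOp_blockConst, Matrix.one_mulVec]

/-- The same in REAL matrices: `reM Q′_n · (n^d·(reM Q′_n)ᵀ) = 1` — the hypothesis `h` of `…MatrixFormJunction.section_transfer`. [folklore] -/
theorem reM_QsOp_mul_blockConst : reM (QsOp n M) * (((n : ℝ) ^ d) • (reM (QsOp n M))ᵀ) = 1 := by
  have hre : IsReal (((n : ℂ) ^ d) • (QsOp n M)ᴴ) :=
    ((isReal_QsOp n M).conjTranspose).smul (by simp)
  have h := congrArg reM (QsOp_mul_smul_conjTranspose n M)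
  rw [(isReal_QsOp n M).reM_mul hre, B5RealFields.reM_one] at h
  rw [← B5RealFields.reM_conjTranspose, ← B5RealFields.reM_smul_ofReal]
  push_cast
  exact h

/-- **THE BLOCK-CONSTANT SECTION AS A CLM**: for `D` characterised by `reM Q′_n` there is `T₀ : F →L E`, characterised by `n^d·(reM Q′_n)ᵀ`
(`T₀ g = g ∘ blockOf`), with `D (T₀ g) = g` — so the `hT` slot of §4 ∕ DMT is NOT EMPTY on print's torus. [folklore] -/
theorem exists_blockConstant_section
    {D : EuclideanSpace ℝ (Tor (fine n M)) →L[ℝ] EuclideanSpace ℝ (Tor M)} (hD : ∀ x, ofLp (D x) = reM (QsOp n M) *ᵥ ofLp x) :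
    ∃ T : EuclideanSpace ℝ (Tor M) →L[ℝ] EuclideanSpace ℝ (Tor (fine n M)),
      (∀ g, ofLp (T g) = (((n : ℝ) ^ d) • (reM (QsOp n M))ᵀ) *ᵥ ofLp g) ∧ ∀ g, D (T g) = g := by
  classical
  obtain ⟨T, hT⟩ := exists_map (ι := Tor M) (κ := Tor (fine n M)) (((n : ℝ) ^ d) • (reM (QsOp n M))ᵀ)
  exact ⟨T, hT, MatrixFormJunction.section_transfer hD hT (reM_QsOp_mul_blockConst n M)⟩

end BlockConstant

/-- **THE PER-SCALE RESET WITH EVERY LETTER DISCHARGED ON PRINT's TORUS (block-constant section).**  There EXIST `Q`, `R`, `D`, `D₂` and a section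
`T₀` of `D` (the five maps characterised in coordinates by BADD's `η^d`-weighted fine Dirichlet matrix, the unit-lattice Dirichlet matrix,
`reM Q′_n`, `reM Q′_L` and the block-constant extension `n^d·(reM Q′_n)ᵀ`) with `D₂ g = 0 ⟹ 1·(2∕L²)·‖g‖² ≤ (Q.bilinearComp T₀ T₀) g g` for every
`g`.  (Honest: along the block-constant `T₀` the transported form is the crude `n·R` — the floor is what is claimed; the minimising section,
where `Q.bilinearComp T T` is the effective form, is a consumer's `T` in `hardFlow_nextFloor_of_section`.) [folklore] -/
theorem hardFlow_nextFloor_blockConstant (n : ℕ) [NeZero n] :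
    ∃ (Q : EuclideanSpace ℝ (Tor (fine n (fine L M'))) →L[ℝ] EuclideanSpace ℝ (Tor (fine n (fine L M'))) →L[ℝ] ℝ)
      (R : EuclideanSpace ℝ (Tor (fine L M')) →L[ℝ] EuclideanSpace ℝ (Tor (fine L M')) →L[ℝ] ℝ)
      (D : EuclideanSpace ℝ (Tor (fine n (fine L M'))) →L[ℝ] EuclideanSpace ℝ (Tor (fine L M')))
      (D₂ : EuclideanSpace ℝ (Tor (fine L M')) →L[ℝ] EuclideanSpace ℝ (Tor M'))
      (T : EuclideanSpace ℝ (Tor (fine L M')) →L[ℝ] EuclideanSpace ℝ (Tor (fine n (fine L M')))),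
      (∀ x y, Q x y = ofLp x ⬝ᵥ
        (((1 / (n : ℝ) ^ d) • ((reM (GradOp (fine n (fine L M')) (n : ℂ)))ᵀ * reM (GradOp (fine n (fine L M')) (n : ℂ)))) *ᵥ ofLp y)) ∧
      (∀ g h, R g h = ofLp g ⬝ᵥ (((reM (GradOp (fine L M') 1))ᵀ * reM (GradOp (fine L M') 1)) *ᵥ ofLp h)) ∧
      (∀ x, ofLp (D x) = reM (QsOp n (fine L M')) *ᵥ ofLp x) ∧
      (∀ g, ofLp (D₂ g) = reM (QsOp L M') *ᵥ ofLp g) ∧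
      (∀ g, ofLp (T g) = (((n : ℝ) ^ d) • (reM (QsOp n (fine L M')))ᵀ) *ᵥ ofLp g) ∧
      (∀ g, D (T g) = g) ∧
      (∀ g, D₂ g = 0 → 1 * (2 / (L : ℝ) ^ 2) * ‖g‖ ^ 2 ≤ (Q.bilinearComp T T) g g) := by
  classical
  obtain ⟨Q, hQ⟩ := exists_form (ι := Tor (fine n (fine L M')))
    ((1 / (n : ℝ) ^ d) • ((reM (GradOp (fine n (fine L M')) (n : ℂ)))ᵀ * reM (GradOp (fine n (fine L M')) (n : ℂ))))
  obtain ⟨R, hR⟩ := exists_form (ι := Tor (fine L M')) ((reM (GradOp (fine L M') 1))ᵀ * reM (GradOp (fine L M') 1))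
  obtain ⟨D, hD⟩ := exists_map (ι := Tor (fine n (fine L M'))) (κ := Tor (fine L M')) (reM (QsOp n (fine L M')))
  obtain ⟨D₂, hD₂⟩ := exists_map (ι := Tor (fine L M')) (κ := Tor M') (reM (QsOp L M'))
  obtain ⟨T, hT, hsec⟩ := exists_blockConstant_section n (fine L M') hD
  exact ⟨Q, R, D, D₂, T, hQ, hR, hD, hD₂, hT, hsec, hardFlow_nextFloor_of_section L M' n hQ hR hD hsec hD₂⟩

/-! ## §5. Toy -/

/-- Toy: the next-fibre floor `2∕L²` is `1∕2` at `L = 2` and `2∕9` at `L = 3`. -/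
example : (2 : ℝ) / (2 : ℕ) ^ 2 = 1 / 2 ∧ (2 : ℝ) / (3 : ℕ) ^ 2 = 2 / 9 := by norm_num

end Summit.QuantumFields.BalabanUV.T4Continuum.NE7b.BlockAverageKernelFloor
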